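import Summits.BirchSwinnertonDyer.BirchSwinnertonDyer.Theorems.SemiOrdinaryEisensteinDescentShaTwoCochainWeilTransport
import Summits.BirchSwinnertonDyer.BirchSwinnertonDyer.Theorems.SemiOrdinaryEisensteinDescentShaTwoCochainPairChoiceIndependence
import HarnessLib

/-!
# The Ш²-cochain bridge, final glue — LOCAL half: under `hPTc`'s hypothesis for `f`, EVERY admissible choice for `(F′, γ)` in the
# evaluation currency (`F′` a cocycle of `θ′_* [f]`, `γ` locally trivial) has vanishing sum of local terms for THE maps

Route `SemiOrdinaryEisensteinDescent` (BSD, rung W-ALL row 2·3@3), Kolyvagin column, Cassels–Tate lane: print item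
`CasselsTateLevelInputsFact` (stmt-BirchSwinnertonDyer-20191), last input `hPTc` (p628097).  The shell
`ShaTwoCochainTheta.casselsTate_levelInputs_of_readout_vanishing_flip` (p639762) reduced CT(K) for THE maps to ONE binder: for the
`h : N₁ → C̄` exhausting `θ′_* [f]` and `y ∈ Ш¹(K, E[m])`, `classBarInv(Φ⁻¹ y ∘ ∂h) = 0`.  The bridge computes that invariant as
`(1/m²) · Σ_v inv_v[φ_v ∪_{ev♭} γ_v − H_v]` for an EXPLICIT admissible choice `(H; φ_v)` for `(F′, γ)` in the evaluation currency
(`F′` a `2`-cocycle of `E[m]^D` representing `Ψ h = θ′_* [f]`, `γ ∈ y`; steps S2/S3, w3 g7 / w2 g11).  THIS FILE is the other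
half of memo §1 (vii): such sums VANISH — for ANY admissible choice, not only the bridge's:

* `exists_transport_cochain` — from `θ′_* [f] = [F′]` in `H²(K, E[m]^D)` a continuous `α : Γ_K → E[m]^D` with
  `θ′∘f − F′ = dα` pointwise (`map_twoCocycleClass`, `twoCocycleClass_eq_zero_iff`): the binder `hα` of `…ShaTwoCochainWeilTransport`
  PRODUCED from an equality of classes;
* `transport_locClass₂_eq` / `transport_localTerm_eq` — the admissible choice `(h − α ∪ γ; θ′∘φ_v − α|_v)` transported from a
  `PTChoice` `C` for `(f, γ)` (w3 g7's `dTwo_transportH`, `dOne_transportPhi`) has the local CLASSES and local TERMS of `C`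
  (`transport_localCocycle_apply_eq`, on the nose);
* **`evFlip_support_and_sum_eq_zero`** — if `f` satisfies `hPTc`'s hypothesis (for every locally trivial `g` SOME `PTChoice` for
  `(f, g)` has canonical local terms supported on a finite `S` and summing to `0`), `θ′∘f − F′ = dα`, and `γ` is locally trivial,
  then EVERY admissible raw choice `(h₂; φ₂_v)` for `(F′, γ)` under `P = (tateDualPairing ρ (m·m)).flip` (the format of
  `…ShaTwoCochainPairChoiceIndependence`, local pairings `P.restrict (absGaloisRestrict K K_v)`) has a PRODUCED finite `S′` off which
  its canonical local terms vanish and over which they sum to `0` (`pair_support_and_sum_eq_zero_canonical` against the transported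
  choice);
* `evFlip_support_and_sum_eq_zero_of_class_eq` — the same with `α` produced from `θ′_* [f] = [F′]`.

So after this file CT 20191 for THE maps needs exactly: the bridge's explicit `(F′, H, φ_v)` for the exhausting `h` and `γ ∈ y`
(S2-inst) with `Σ_{v ∈ S′} canonical_v[φ_v ∪ γ_v − H_v]` read as `m² · classBarInv(Φ⁻¹ y ∘ ∂h)` (S3 + the μ/Brauer dictionary).
THEOREMS ONLY (no definition, no instance, no named fact); no case of BSD, Poitou–Tate or Cassels–Tate is proved here.  Width seat
`bsd-wall-soed-p2-w4` g2; `--supports stmt-BirchSwinnertonDyer-20480`, helper; route-free.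

## References
* [MilneADT2006] J. S. Milne, *Arithmetic Duality Theorems*, 2nd ed. (2006), Ch. I Thm. 4.10 (a) (proof, p. 58); §6 proof of
  Prop. 6.9 ("independent of the choices"), Thm. 6.13 (a) (p. 88).
* [CasselsFrohlichANT1967] J. W. S. Cassels, A. Fröhlich (eds.), *Algebraic Number Theory* (1967), Ch. VII §7.3, §11.2.
-/

noncomputable section

open scoped Classical

universe u

-- `Summit.<P>.<Sub>` repeats `BirchSwinnertonDyer` by the tree's layout convention (D-0017)
set_option linter.dupNamespace false
set_option autoImplicit false

namespace Summit.BirchSwinnertonDyer.BirchSwinnertonDyer.Theorems.ShaTwoCochainTheta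

open CategoryTheory _root_.WeierstrassCurve Field Function NumberField
open Literature.NumberTheory.EllipticCurves
open Literature.NumberTheory.GaloisRepresentations Literature.NumberTheory.GaloisCohomology
open Literature.NumberTheory.GaloisRepresentations.DiscreteGaloisModule (mu MuCarrier pairing TateDual tateDual
  tateDualPairing pairingDualHom pairingDualIntertwining)
open Summit.BirchSwinnertonDyer.BirchSwinnertonDyer.Theorems.ShaTwoCochain
open scoped ContRepresentation

variable {K : Type} [Field K] [NumberField K] {W : WeierstrassCurve K} {m : ℕ} [NeZero m]
variable {e : geomTorsion W ((m * m : ℕ) : ℤ) → geomTorsion W ((m * m : ℕ) : ℤ) → AlgebraicClosure K}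
  {hμ : ∀ S T, e S T ^ (m * m) = 1}
  {hadd₁ : ∀ S₁ S₂ T, e (S₁ + S₂) T = e S₁ T * e S₂ T}
  {hadd₂ : ∀ S T₁ T₂, e S (T₁ + T₂) = e S T₁ * e S T₂}
  {hgal : ∀ (σ : absoluteGaloisGroup K) (S T : geomTorsion W ((m * m : ℕ) : ℤ)), σ • e S T = e (σ • S) (σ • T)}
variable [Finite (geomTorsion W (m : ℤ))]

/-! ## §1 The transport cochain `α` from an equality of classes -/

/-- **`θ′_* [f] = [F′]` in `H²(K, E[m]^D)` gives a continuous `α : Γ_K → E[m]^D` with `θ′∘f − F′ = dα` pointwise** — the binder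
`hα` of `…ShaTwoCochainWeilTransport` (`θ′ = pairingDualHom (m·m) desc.flip`).  (`H²(θ′)[f] = [θ′ ∘ f]` by `map_twoCocycleClass`;
a `2`-cocycle of class `0` is a coboundary, `twoCocycleClass_eq_zero_iff`.) [cite: SerreGaloisCohomology1997, I §2.2–2.3] -/
theorem exists_transport_cochain (hgal' : ∀ (σ : absoluteGaloisGroup K) (S T : geomTorsion W ((m * m : ℕ) : ℤ)),
      σ • e S T = e (σ • S) (σ • T))
    (f : contTwoCocycles (W.torsionGaloisModule (m : ℤ)).toTopRep)
    (F' : contTwoCocycles ((W.torsionGaloisModule (m : ℤ)).tateDual (m * m)).toTopRep)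
    (hclass : galoisCohomology.map (pairingDualIntertwining
        (ρ₁ := W.torsionGaloisModule (m : ℤ)) (ρ₂ := W.torsionGaloisModule (m : ℤ))
        (B := (descendHom W m m e hμ hadd₁ hadd₂).flip) (descendHom_flip_smul W m e hμ hadd₁ hadd₂ hgal')) 2
        (twoCocycleClass _ f) = twoCocycleClass _ F') :
    ∃ α : C(absoluteGaloisGroup K, TateDual K (geomTorsion W (m : ℤ)) (m * m)),
      ∀ σ τ : absoluteGaloisGroup K,
        pairingDualHom (m * m) (descendHom W m m e hμ hadd₁ hadd₂).flip (f.1 (σ, τ)) - F'.1 (σ, τ) =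
          (W.torsionGaloisModule (m : ℤ)).tateDual (m * m) σ (α τ) - α (σ * τ) + α σ := by
  haveI := absoluteGaloisGroup_compactSpace K
  -- `θ′_* [f] = [θ′ ∘ f]` (functoriality on explicit cocycles)
  have hmap := map_twoCocycleClass (ContinuousMonoidHom.id (absoluteGaloisGroup K))
    (X := (W.torsionGaloisModule (m : ℤ)).toTopRep) (Y := ((W.torsionGaloisModule (m : ℤ)).tateDual (m * m)).toTopRep)
    (TopRep.ofHom ⟨(pairingDualIntertwining
        (ρ₁ := W.torsionGaloisModule (m : ℤ)) (ρ₂ := W.torsionGaloisModule (m : ℤ))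
        (B := (descendHom W m m e hμ hadd₁ hadd₂).flip) (descendHom_flip_smul W m e hμ hadd₁ hadd₂ hgal')).toContinuousLinearMap,
      (pairingDualIntertwining
        (ρ₁ := W.torsionGaloisModule (m : ℤ)) (ρ₂ := W.torsionGaloisModule (m : ℤ))
        (B := (descendHom W m m e hμ hadd₁ hadd₂).flip) (descendHom_flip_smul W m e hμ hadd₁ hadd₂ hgal')).isIntertwining'⟩) f
  -- the difference `θ′∘f − F′` has class `0`, hence is a coboundary
  have h0 : twoCocycleClass _ (contTwoCocycles.pullback (ContinuousMonoidHom.id (absoluteGaloisGroup K))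
      (X := (W.torsionGaloisModule (m : ℤ)).toTopRep) (Y := ((W.torsionGaloisModule (m : ℤ)).tateDual (m * m)).toTopRep)
      (TopRep.ofHom ⟨(pairingDualIntertwining
        (ρ₁ := W.torsionGaloisModule (m : ℤ)) (ρ₂ := W.torsionGaloisModule (m : ℤ))
        (B := (descendHom W m m e hμ hadd₁ hadd₂).flip) (descendHom_flip_smul W m e hμ hadd₁ hadd₂ hgal')).toContinuousLinearMap,
      (pairingDualIntertwining
        (ρ₁ := W.torsionGaloisModule (m : ℤ)) (ρ₂ := W.torsionGaloisModule (m : ℤ))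
        (B := (descendHom W m m e hμ hadd₁ hadd₂).flip) (descendHom_flip_smul W m e hμ hadd₁ hadd₂ hgal')).isIntertwining'⟩) f - F') = 0 := by
    rw [twoCocycleClass_sub, ← hmap]
    exact sub_eq_zero.2 hclass
  obtain ⟨α, hα⟩ := (twoCocycleClass_eq_zero_iff _ _).1 h0
  refine ⟨α, fun σ τ => ?_⟩
  have h1 := hα σ τ
  rw [Submodule.coe_sub, ContinuousMap.sub_apply, contTwoCocycles.pullback_apply] at h1
  exact h1

/-! ## §2 The transported choice has the local classes and local terms of `C` -/

section Transport

variable {f : contTwoCocycles (W.torsionGaloisModule (m : ℤ)).toTopRep}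
  {g : contOneCocycles (W.torsionGaloisModule (m : ℤ)).toTopRep}
  (C : PTChoice W m e hμ hadd₁ hadd₂ hgal f g)
  (F' : contTwoCocycles ((W.torsionGaloisModule (m : ℤ)).tateDual (m * m)).toTopRep)
  (α : C(absoluteGaloisGroup K, TateDual K (geomTorsion W (m : ℤ)) (m * m)))
  (hα : ∀ σ τ : absoluteGaloisGroup K,
    pairingDualHom (m * m) (descendHom W m m e hμ hadd₁ hadd₂).flip (f.1 (σ, τ)) - F'.1 (σ, τ) =
      (W.torsionGaloisModule (m : ℤ)).tateDual (m * m) σ (α τ) - α (σ * τ) + α σ)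

include hα in
/-- **The transported choice `(h − α ∪ γ; θ′∘φ_v − α|_v)` has the local CLASS of `C` at every place** (its local cocycle IS
`C.localCocycle v`, `transport_localCocycle_apply_eq`). [cite: MilneADT2006, I §6, proof of Prop. 6.9] -/
theorem transport_locClass₂_eq (v : Place K) :
    locClass₂ (mu K (m * m)) (Place.Completion v)
      ((((tateDualPairing (W.torsionGaloisModule (m : ℤ)) (m * m)).flip).restrict
          (absGaloisRestrict K (Place.Completion v))).cupSubCocycle
        ((⟨pairingDualHom (m * m) (descendHom W m m e hμ hadd₁ hadd₂).flip, continuous_of_discreteTopology⟩ :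
              C(geomTorsion W (m : ℤ), TateDual K (geomTorsion W (m : ℤ)) (m * m))).comp (C.φ v) -
            resCochain₁ (Place.Completion v) α)
        (resOne (W.torsionGaloisModule (m : ℤ)) (Place.Completion v) g)
        (resTwo ((W.torsionGaloisModule (m : ℤ)).tateDual (m * m)) (Place.Completion v) F')
        (dOne_transportPhi C F' α hα v)
        (resCochain₂ (Place.Completion v)
          (C.h - ((tateDualPairing (W.torsionGaloisModule (m : ℤ)) (m * m)).flip).cochainCup₁₁ α g))
        (dTwo_res_transportH C F' α hα v)) =
      locClass₂ (mu K (m * m)) (Place.Completion v) (C.localCocycle v) := by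
  congr 1
  exact Subtype.ext (ContinuousMap.ext fun p => by
    obtain ⟨σ, τ⟩ := p
    exact transport_localCocycle_apply_eq C F' α hα v σ τ)

include hα in
/-- Hence **the transported choice has the local TERMS of `C`** for any family `inv`. [cite: MilneADT2006, I §6, proof of Prop. 6.9] -/
theorem transport_localTerm_eq (inv : LocalInvariants K (m * m)) (v : Place K) :
    inv v (locClass₂ (mu K (m * m)) (Place.Completion v)
      ((((tateDualPairing (W.torsionGaloisModule (m : ℤ)) (m * m)).flip).restrict
          (absGaloisRestrict K (Place.Completion v))).cupSubCocycle
        ((⟨pairingDualHom (m * m) (descendHom W m m e hμ hadd₁ hadd₂).flip, continuous_of_discreteTopology⟩ :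
              C(geomTorsion W (m : ℤ), TateDual K (geomTorsion W (m : ℤ)) (m * m))).comp (C.φ v) -
            resCochain₁ (Place.Completion v) α)
        (resOne (W.torsionGaloisModule (m : ℤ)) (Place.Completion v) g)
        (resTwo ((W.torsionGaloisModule (m : ℤ)).tateDual (m * m)) (Place.Completion v) F')
        (dOne_transportPhi C F' α hα v)
        (resCochain₂ (Place.Completion v)
          (C.h - ((tateDualPairing (W.torsionGaloisModule (m : ℤ)) (m * m)).flip).cochainCup₁₁ α g))
        (dTwo_res_transportH C F' α hα v))) =
      C.localTerm inv v := by
  rw [transport_locClass₂_eq C F' α hα v, PTChoice.localTerm]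

end Transport

/-! ## §3 Every admissible choice for `(F′, γ)` in the evaluation currency has vanishing sum of local terms -/

/-- **LOCAL HALF OF THE GLUE.**  Let `f` be a `2`-cocycle of `E[m]` satisfying `hPTc`'s hypothesis for THE maps at level `m²`
(for every locally trivial `1`-cocycle `g` SOME admissible `PTChoice` for `(f, g)` has canonical local terms vanishing off a finite
`S` and summing to `0` over `S`), `F′` a `2`-cocycle of `E[m]^D` with `θ′∘f − F′ = dα`, and `γ` a locally trivial `1`-cocycle of
`E[m]`.  Then for EVERY admissible raw choice `(h₂; φ₂_v)` for `(F′, γ)` under the flipped evaluation pairing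
`P = (tateDualPairing ρ (m·m)).flip : E[m]^D × E[m] → μ_{m²}` (global `dh₂ = F′ ∪_P γ`, local `dφ₂_v = F′_v`) there is a finite
`S′` off which its canonical local terms `canonical_v [φ₂_v ∪_P γ_v − h₂_v]` vanish and over which they sum to `0`.  Proof:
`hPTc`'s choice `C` for `(f, γ)` transports to an admissible `P`-choice with the SAME local terms (§2), so with support `S` and
sum `0`; independence of the admissible choice for THE maps with a produced support (`pair_support_and_sum_eq_zero_canonical`,
w3 g7) transfers this to `(h₂; φ₂_v)`. [cite: MilneADT2006, Ch. I Thm. 4.10 (a) (proof, p. 58); §6 proof of Prop. 6.9]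
[cite: CasselsFrohlichANT1967, Ch. VII §7.3, §11.2] -/
theorem evFlip_support_and_sum_eq_zero [NeZero (m * m)]
    {f : contTwoCocycles (W.torsionGaloisModule (m : ℤ)).toTopRep}
    (hf : ∀ g : contOneCocycles (W.torsionGaloisModule (m : ℤ)).toTopRep,
      (∀ v : Place K, locClass (W.torsionGaloisModule (m : ℤ)) (Place.Completion v)
          (resOne (W.torsionGaloisModule (m : ℤ)) (Place.Completion v) g) = 0) →
      ∃ (C : PTChoice W m e hμ hadd₁ hadd₂ hgal f g) (S : Finset (Place K)),
        (∀ v ∉ S, C.localTerm (LocalInvariants.canonical K (m * m)) v = 0) ∧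
          ∑ v ∈ S, C.localTerm (LocalInvariants.canonical K (m * m)) v = 0)
    (F' : contTwoCocycles ((W.torsionGaloisModule (m : ℤ)).tateDual (m * m)).toTopRep)
    (α : C(absoluteGaloisGroup K, TateDual K (geomTorsion W (m : ℤ)) (m * m)))
    (hα : ∀ σ τ : absoluteGaloisGroup K,
      pairingDualHom (m * m) (descendHom W m m e hμ hadd₁ hadd₂).flip (f.1 (σ, τ)) - F'.1 (σ, τ) =
        (W.torsionGaloisModule (m : ℤ)).tateDual (m * m) σ (α τ) - α (σ * τ) + α σ)
    {g : contOneCocycles (W.torsionGaloisModule (m : ℤ)).toTopRep}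
    (hg : ∀ v : Place K, locClass (W.torsionGaloisModule (m : ℤ)) (Place.Completion v)
      (resOne (W.torsionGaloisModule (m : ℤ)) (Place.Completion v) g) = 0)
    (h₂ : C(absoluteGaloisGroup K × absoluteGaloisGroup K, MuCarrier K (m * m)))
    (hh₂ : ∀ σ τ υ : absoluteGaloisGroup K,
      (((tateDualPairing (W.torsionGaloisModule (m : ℤ)) (m * m)).flip).cupCocycle₂₁ F' g).1 (σ, τ, υ) =
        dTwo (mu K (m * m)).toTopRep h₂ σ τ υ)
    (φ₂ : (v : Place K) → C(absoluteGaloisGroup (Place.Completion v), TateDual K (geomTorsion W (m : ℤ)) (m * m)))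
    (hφ₂ : ∀ (v : Place K) (σ τ : absoluteGaloisGroup (Place.Completion v)),
      (resTwo ((W.torsionGaloisModule (m : ℤ)).tateDual (m * m)) (Place.Completion v) F').1 (σ, τ) =
        (DiscreteGaloisModule.toTopRep (GaloisRep.restrictField (Place.Completion v)
            ((W.torsionGaloisModule (m : ℤ)).tateDual (m * m)))).ρ σ (φ₂ v τ) - φ₂ v (σ * τ) + φ₂ v σ) :
    ∃ S' : Finset (Place K),
      (∀ v ∉ S', LocalInvariants.canonical K (m * m) v (locClass₂ (mu K (m * m)) (Place.Completion v)
        ((((tateDualPairing (W.torsionGaloisModule (m : ℤ)) (m * m)).flip).restrict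
            (absGaloisRestrict K (Place.Completion v))).cupSubCocycle (φ₂ v)
          (resOne (W.torsionGaloisModule (m : ℤ)) (Place.Completion v) g)
          (resTwo ((W.torsionGaloisModule (m : ℤ)).tateDual (m * m)) (Place.Completion v) F') (hφ₂ v)
          (resCochain₂ (Place.Completion v) h₂)
          (dTwo_resCochain₂_of_cupCocycle₂₁ ((tateDualPairing (W.torsionGaloisModule (m : ℤ)) (m * m)).flip)
            (fun v => ((tateDualPairing (W.torsionGaloisModule (m : ℤ)) (m * m)).flip).restrict
              (absGaloisRestrict K (Place.Completion v)))
            (fun _ _ _ => rfl) h₂ hh₂ v))) = 0) ∧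
      ∑ v ∈ S', LocalInvariants.canonical K (m * m) v (locClass₂ (mu K (m * m)) (Place.Completion v)
        ((((tateDualPairing (W.torsionGaloisModule (m : ℤ)) (m * m)).flip).restrict
            (absGaloisRestrict K (Place.Completion v))).cupSubCocycle (φ₂ v)
          (resOne (W.torsionGaloisModule (m : ℤ)) (Place.Completion v) g)
          (resTwo ((W.torsionGaloisModule (m : ℤ)).tateDual (m * m)) (Place.Completion v) F') (hφ₂ v)
          (resCochain₂ (Place.Completion v) h₂)
          (dTwo_resCochain₂_of_cupCocycle₂₁ ((tateDualPairing (W.torsionGaloisModule (m : ℤ)) (m * m)).flip)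
            (fun v => ((tateDualPairing (W.torsionGaloisModule (m : ℤ)) (m * m)).flip).restrict
              (absGaloisRestrict K (Place.Completion v)))
            (fun _ _ _ => rfl) h₂ hh₂ v))) = 0 := by
  obtain ⟨C, S, hS, hsum⟩ := hf g hg
  obtain ⟨S', -, hS', hsum'⟩ := pair_support_and_sum_eq_zero_canonical
    ((tateDualPairing (W.torsionGaloisModule (m : ℤ)) (m * m)).flip)
    (fun v => ((tateDualPairing (W.torsionGaloisModule (m : ℤ)) (m * m)).flip).restrict
      (absGaloisRestrict K (Place.Completion v)))
    (fun _ _ _ => rfl)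
    (C.h - ((tateDualPairing (W.torsionGaloisModule (m : ℤ)) (m * m)).flip).cochainCup₁₁ α g) h₂
    (dTwo_transportH C F' α hα) hh₂
    (fun v => (⟨pairingDualHom (m * m) (descendHom W m m e hμ hadd₁ hadd₂).flip, continuous_of_discreteTopology⟩ :
        C(geomTorsion W (m : ℤ), TateDual K (geomTorsion W (m : ℤ)) (m * m))).comp (C.φ v) -
      resCochain₁ (Place.Completion v) α)
    φ₂
    (dOne_transportPhi C F' α hα) hφ₂ hg
    (S := S) (fun v hv => (transport_localTerm_eq C F' α hα (LocalInvariants.canonical K (m * m)) v).trans (hS v hv))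
    ((Finset.sum_congr rfl fun v _ =>
      transport_localTerm_eq C F' α hα (LocalInvariants.canonical K (m * m)) v).trans hsum)
  exact ⟨S', hS', hsum'⟩

/-- **The same with the transport cochain PRODUCED from `θ′_* [f] = [F′]`** (§1). [cite: MilneADT2006, Ch. I Thm. 4.10 (a) (proof, p. 58)] -/
theorem evFlip_support_and_sum_eq_zero_of_class_eq [NeZero (m * m)]
    {f : contTwoCocycles (W.torsionGaloisModule (m : ℤ)).toTopRep}
    (hf : ∀ g : contOneCocycles (W.torsionGaloisModule (m : ℤ)).toTopRep,
      (∀ v : Place K, locClass (W.torsionGaloisModule (m : ℤ)) (Place.Completion v)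
          (resOne (W.torsionGaloisModule (m : ℤ)) (Place.Completion v) g) = 0) →
      ∃ (C : PTChoice W m e hμ hadd₁ hadd₂ hgal f g) (S : Finset (Place K)),
        (∀ v ∉ S, C.localTerm (LocalInvariants.canonical K (m * m)) v = 0) ∧
          ∑ v ∈ S, C.localTerm (LocalInvariants.canonical K (m * m)) v = 0)
    (F' : contTwoCocycles ((W.torsionGaloisModule (m : ℤ)).tateDual (m * m)).toTopRep)
    (hclass : galoisCohomology.map (pairingDualIntertwining
        (ρ₁ := W.torsionGaloisModule (m : ℤ)) (ρ₂ := W.torsionGaloisModule (m : ℤ))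
        (B := (descendHom W m m e hμ hadd₁ hadd₂).flip) (descendHom_flip_smul W m e hμ hadd₁ hadd₂ hgal)) 2
        (twoCocycleClass _ f) = twoCocycleClass _ F')
    {g : contOneCocycles (W.torsionGaloisModule (m : ℤ)).toTopRep}
    (hg : ∀ v : Place K, locClass (W.torsionGaloisModule (m : ℤ)) (Place.Completion v)
      (resOne (W.torsionGaloisModule (m : ℤ)) (Place.Completion v) g) = 0)
    (h₂ : C(absoluteGaloisGroup K × absoluteGaloisGroup K, MuCarrier K (m * m)))
    (hh₂ : ∀ σ τ υ : absoluteGaloisGroup K,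
      (((tateDualPairing (W.torsionGaloisModule (m : ℤ)) (m * m)).flip).cupCocycle₂₁ F' g).1 (σ, τ, υ) =
        dTwo (mu K (m * m)).toTopRep h₂ σ τ υ)
    (φ₂ : (v : Place K) → C(absoluteGaloisGroup (Place.Completion v), TateDual K (geomTorsion W (m : ℤ)) (m * m)))
    (hφ₂ : ∀ (v : Place K) (σ τ : absoluteGaloisGroup (Place.Completion v)),
      (resTwo ((W.torsionGaloisModule (m : ℤ)).tateDual (m * m)) (Place.Completion v) F').1 (σ, τ) =
        (DiscreteGaloisModule.toTopRep (GaloisRep.restrictField (Place.Completion v)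
            ((W.torsionGaloisModule (m : ℤ)).tateDual (m * m)))).ρ σ (φ₂ v τ) - φ₂ v (σ * τ) + φ₂ v σ) :
    ∃ S' : Finset (Place K),
      (∀ v ∉ S', LocalInvariants.canonical K (m * m) v (locClass₂ (mu K (m * m)) (Place.Completion v)
        ((((tateDualPairing (W.torsionGaloisModule (m : ℤ)) (m * m)).flip).restrict
            (absGaloisRestrict K (Place.Completion v))).cupSubCocycle (φ₂ v)
          (resOne (W.torsionGaloisModule (m : ℤ)) (Place.Completion v) g)
          (resTwo ((W.torsionGaloisModule (m : ℤ)).tateDual (m * m)) (Place.Completion v) F') (hφ₂ v)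
          (resCochain₂ (Place.Completion v) h₂)
          (dTwo_resCochain₂_of_cupCocycle₂₁ ((tateDualPairing (W.torsionGaloisModule (m : ℤ)) (m * m)).flip)
            (fun v => ((tateDualPairing (W.torsionGaloisModule (m : ℤ)) (m * m)).flip).restrict
              (absGaloisRestrict K (Place.Completion v)))
            (fun _ _ _ => rfl) h₂ hh₂ v))) = 0) ∧
      ∑ v ∈ S', LocalInvariants.canonical K (m * m) v (locClass₂ (mu K (m * m)) (Place.Completion v)
        ((((tateDualPairing (W.torsionGaloisModule (m : ℤ)) (m * m)).flip).restrict
            (absGaloisRestrict K (Place.Completion v))).cupSubCocycle (φ₂ v)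
          (resOne (W.torsionGaloisModule (m : ℤ)) (Place.Completion v) g)
          (resTwo ((W.torsionGaloisModule (m : ℤ)).tateDual (m * m)) (Place.Completion v) F') (hφ₂ v)
          (resCochain₂ (Place.Completion v) h₂)
          (dTwo_resCochain₂_of_cupCocycle₂₁ ((tateDualPairing (W.torsionGaloisModule (m : ℤ)) (m * m)).flip)
            (fun v => ((tateDualPairing (W.torsionGaloisModule (m : ℤ)) (m * m)).flip).restrict
              (absGaloisRestrict K (Place.Completion v)))
            (fun _ _ _ => rfl) h₂ hh₂ v))) = 0 := by
  obtain ⟨α, hα⟩ := exists_transport_cochain hgal f F' hclass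
  exact evFlip_support_and_sum_eq_zero hf F' α hα hg h₂ hh₂ φ₂ hφ₂

end Summit.BirchSwinnertonDyer.BirchSwinnertonDyer.Theorems.ShaTwoCochainTheta

end
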